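import Literature.Computability.AlgebraicComplexity.MultiplicativelyDisjointCircuits
import Literature.Computability.AlgebraicComplexity.ExactVP0PerProjection
import Literature.Computability.AlgebraicComplexity.HomogenisationFormalDegree
import Literature.Computability.AlgebraicComplexity.ZModCircuitIntegerCodes
import HarnessLib

/-!
# Prop. 2.6 of Bürgisser's 2024 survey (Malod–Portier 2008): every circuit is simulated by a
# multiplicatively disjoint circuit of size `|Φ| · deg Φ` — construction + PROOFS

Topic `Computability/AlgebraicComplexity`. Cell `val-lit`, row Bur2024-A (P. Bürgisser,
*Completeness classes in algebraic complexity theory*, arXiv:2406.06217, 2024; held text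
`paper:arxiv-2406.06217`, p0005 L116–L120, p0006 L58–L61 and L78–L80):

> We also have the following result from [mapo:08]. **Proposition 2.6.** Let `Φ` be an arithmetic
> circuit computing `f`. Then there is a multiplicatively disjoint arithmetic circuit `Ψ` of size
> at most `O(|Φ| deg Φ)` computing `f`.
> **Remark 2.10(1).** By Proposition 2.6, the class `VP` [Def. 2.9(1): p-families computed by
> multiplicatively disjoint circuits of polynomial size] can also be characterized as the set of
> sequences `(f_n)` of polynomials such that `deg f_n` and `L(f_n)` grow at most polynomially in `n`.

The original [cite: MalodPortier2008, Lemma 2] (held text `paper:doi-10-1016-j-jco-2006-09-006`,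
p0004 L34–35, proof p0005 L10–41): «If `C` is a circuit of size `t` and degree `d`, there exists a
MD circuit `C'`, which computes the same polynomial and whose size is less than `dt`», proved by
CLONES: «`C_f` should contain distinct gates `α_1, …, α_{d+1−e}` which each compute the polynomial
computed by `α` in `C` … the gates in the sub-circuit of `C_f` associated with the clone `α_k` are
clones whose index lies between `k` and `k + e − 1`»; a multiplication clone `α_i` «receives an
arrow from the clone `β_i` and an arrow from the clone `γ_{i+e_1}`», an addition clone `α_i` from
`β_i` and `γ_i`; and [cite: MalodPortier2008, Thm. 1]: «A sequence of polynomials `(f_n)` belongs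
to `VP` if and only if there exists a sequence `(C_n)` of MD circuits, of polynomially bounded
size, such that `C_n` represents the polynomial `f_n`.» The construction below is exactly this one
(clone index `k` ↦ offset `κ = k − 1`), in the tree's straight-line model.

Construction ("offset copies"; `ArithCircuit.mdSim P D`, for a well-formed fan-in-two circuit `P`
without empty gates — so every gate `v` has formal degree `deg(v) ≥ 1` — and an offset budget
`D ≥ deg P`): gate number `D * v + κ` (`κ < D`) is the copy `(v, κ)` of gate `v`; it is *valid*
when `κ + deg(v) ≤ D` (`ArithCircuit.MdValid`). A valid sum copy `(v, κ)` reads the copies of its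
operands at the same offset `κ`; a valid product copy `(v, κ) = u₁ · u₂` reads `u₁` at offset `κ`
and `u₂` at offset `κ + deg(u₁)` (`ArithCircuit.mdCopyProd`); inputs are read as they are; invalid
copies hold a dummy empty sum and are never referenced. Hence every copy `x` reachable from a
copy `(v, κ)` lives in the offset band `[κ, κ + deg v)` (`ArithCircuit.mdSim_subcircuit_band`),
the two factor sub-circuits of a product copy live in the disjoint bands `[κ, κ + deg u₁)` and
`[κ + deg u₁, κ + deg v)`, and the simulation is multiplicatively disjoint
(`ArithCircuit.isMultiplicativelyDisjoint_mdSim`) — squaring `u · u` is unfolded into two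
disjoint copies of `u`. Valid copies compute the original gate values
(`ArithCircuit.mdSim_value`), so `(P.mdSim D).eval = P.eval` (`ArithCircuit.eval_mdSim`), with
`P.size * D` gates (`ArithCircuit.size_mdSim`), well formed and fan-in two.

Results:
* `ArithCircuit.exists_isMultiplicativelyDisjoint_eval_eq` — **Prop. 2.6** with the explicit
  constant `1`: a well-formed fan-in-two circuit without empty gates is simulated by a well-formed
  fan-in-two multiplicatively disjoint circuit with `|P| · deg P` gates (`deg P` = formal degree);
* `ArithCircuit.exists_isMultiplicativelyDisjoint_computes` — for every polynomial `f`: a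
  multiplicatively disjoint circuit of size `≤ (deg(f)² L(f) + deg f) · max(deg f, 1)` (first
  homogenise to formal degree `≤ max(deg f, 1)`, `exists_computes_formalDegree_le_totalDegree`,
  BCS (21.25));
* `isVPFamily_iff_exists_isMultiplicativelyDisjoint` — **Def. 2.9(1) = Rem. 2.10(1)**: the
  survey's definition of `VP` by multiplicatively disjoint circuits of polynomial size coincides
  with the tree's `IsVPFamily` (Bürgisser 2000, Def. 2.4), for families in p-bounded many
  variables (the `⊇` half is `isVPFamily_of_isMultiplicativelyDisjoint`,
  `MultiplicativelyDisjointCircuits.lean`).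

Theorems and definitions with bodies only; no named facts, no `sorry` (D-0026). Honest framing: a
textbook simulation (vocabulary of the survey's §2.2); `VP ≠ VNP` is NOT proved and nothing here
bears on it.
-/

namespace Literature.Computability.AlgebraicComplexity

namespace ArithCircuit

open MvPolynomial

variable {k : Type*} {σ : Type*}

section Construction

/-- The copy at offset `κ` of an operand: inputs are unchanged, a reference to gate `w` becomes a
reference to the copy `(w, κ)`, stored at index `D * w + κ`. [cite: MalodPortier2008, Lemma 2] -/
def Operand.mdCopy (D κ : ℕ) : Operand k σ → Operand k σ
  | .var i => .var i
  | .const c => .const c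
  | .gate w => .gate (D * w + κ)

/-- The operands of a product gate copied at consecutive offsets: `u₁` at `κ`, `u₂` at
`κ + deg u₁`, `u₃` at `κ + deg u₁ + deg u₂`, … (formal degrees read off `degs`).
[cite: MalodPortier2008, Lemma 2] -/
def mdCopyProd (degs : List ℕ) (D : ℕ) : ℕ → List (Operand k σ) → List (Operand k σ)
  | _, [] => []
  | κ, u :: us => u.mdCopy D κ :: mdCopyProd degs D (κ + u.formalDegree degs) us

/-- The copy at offset `κ` of a gate: a sum gate reads all its operands at offset `κ`, a product
gate reads them at consecutive offsets. [cite: MalodPortier2008, Lemma 2] -/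
def Gate.mdCopy (degs : List ℕ) (D κ : ℕ) : Gate k σ → Gate k σ
  | .sum args => .sum (args.map fun a => (a.1, a.2.mdCopy D κ))
  | .prod args => .prod (mdCopyProd degs D κ args)

/-- The formal degree `deg(v)` of gate `v` of `P` (default `1` out of range, as in
`Operand.formalDegree`). [cite: Burgisser2006, §2.2] -/
def gateDeg (P : ArithCircuit k σ) (v : ℕ) : ℕ :=
  (gateFormalDegrees P.gates).getD v 1

/-- The copy `(v, κ)` is *valid* if `κ + deg(v) ≤ D`; only valid copies carry meaningful gates.
Stated for the index `idx = D * v + κ`. [cite: MalodPortier2008, Lemma 2] -/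
def MdValid (P : ArithCircuit k σ) (D idx : ℕ) : Prop :=
  idx % D + P.gateDeg (idx / D) ≤ D

/-- The gate stored at index `idx = D * v + κ` of the simulation: the copy at offset `κ` of gate
`v` if the copy is valid, and a dummy empty sum otherwise. [cite: MalodPortier2008, Lemma 2] -/
def mdSimGate (P : ArithCircuit k σ) (D idx : ℕ) : Gate k σ :=
  if idx % D + P.gateDeg (idx / D) ≤ D then
    (P.gates.getD (idx / D) (.sum [])).mdCopy (gateFormalDegrees P.gates) D (idx % D)
  else .sum []

/-- **The multiplicatively disjoint simulation** `Ψ` of a circuit `P` with offset budget `D`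
(Malod–Portier 2008, Lemma 2; Bürgisser 2024, Prop. 2.6): `P.size * D` gates, gate `D * v + κ`
being the copy `(v, κ)` of gate `v`, and output the copy at offset `0` of `P`'s output.
[cite: Burgisser2024Completeness, Prop. 2.6] [cite: MalodPortier2008, Lemma 2] -/
def mdSim (P : ArithCircuit k σ) (D : ℕ) : ArithCircuit k σ where
  gates := (List.range (P.size * D)).map (P.mdSimGate D)
  output := P.output.mdCopy D 0

end Construction

section Basic

variable (P : ArithCircuit k σ) (D : ℕ)

/-- The simulation has `|P| · D` gates. [cite: Burgisser2024Completeness, Prop. 2.6] -/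
@[simp]
theorem size_mdSim : (P.mdSim D).size = P.size * D := by
  simp [mdSim, size]

/-- The gate at index `idx` of the simulation. [cite: MalodPortier2008, Lemma 2] -/
theorem mdSim_getElem? {idx : ℕ} (h : idx < P.size * D) :
    (P.mdSim D).gates[idx]? = some (P.mdSimGate D idx) := by
  simp only [mdSim]
  rw [List.getElem?_map, List.getElem?_range h]
  rfl

/-- Index arithmetic: `(D * w + κ) / D = w` for `κ < D`. [folklore] -/
private theorem mdIndex_div {D : ℕ} (hD : 0 < D) (w : ℕ) {κ : ℕ} (hκ : κ < D) : (D * w + κ) / D = w := by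
  rw [Nat.mul_add_div hD, Nat.div_eq_of_lt hκ, add_zero]

/-- Index arithmetic: `(D * w + κ) % D = κ` for `κ < D`. [folklore] -/
private theorem mdIndex_mod (w : ℕ) {D κ : ℕ} (hκ : κ < D) : (D * w + κ) % D = κ := by
  rw [Nat.mul_add_mod, Nat.mod_eq_of_lt hκ]

/-- `mdCopyProd` preserves the number of operands. [cite: MalodPortier2008, Lemma 2] -/
@[simp]
theorem length_mdCopyProd (degs : List ℕ) (D : ℕ) :
    ∀ (κ : ℕ) (args : List (Operand k σ)), (mdCopyProd degs D κ args).length = args.length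
  | _, [] => rfl
  | κ, u :: us => by simp [mdCopyProd, length_mdCopyProd degs D _ us]

/-- Copying preserves the fan-in. [cite: MalodPortier2008, Lemma 2] -/
@[simp]
theorem fanIn_mdCopy (degs : List ℕ) (D κ : ℕ) (g : Gate k σ) :
    (g.mdCopy degs D κ).fanIn = g.fanIn := by
  cases g <;> simp [Gate.mdCopy, Gate.fanIn, Gate.args]

/-- The simulation of a fan-in-two circuit is fan-in two. [cite: Burgisser2024Completeness, Prop. 2.6] -/
theorem isFanInTwo_mdSim (h2 : P.IsFanInTwo) : (P.mdSim D).IsFanInTwo := by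
  intro g hg
  simp only [mdSim, List.mem_map, List.mem_range] at hg
  obtain ⟨idx, -, rfl⟩ := hg
  unfold mdSimGate
  split_ifs with hv
  · rw [fanIn_mdCopy, List.getD_eq_getElem?_getD]
    cases hg' : P.gates[idx / D]? with
    | none => simp [Gate.fanIn, Gate.args]
    | some g => simpa using h2 g (List.mem_of_getElem? hg')
  · simp [Gate.fanIn, Gate.args]

end Basic

section Analysis

variable (P : ArithCircuit k σ) {D : ℕ}

/-- `mdSimGate` at a valid index. [cite: MalodPortier2008, Lemma 2] -/
theorem mdSimGate_of_valid {idx : ℕ} (h : P.MdValid D idx) :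
    P.mdSimGate D idx =
      (P.gates.getD (idx / D) (.sum [])).mdCopy (gateFormalDegrees P.gates) D (idx % D) := by
  unfold mdSimGate
  exact if_pos h

/-- `mdSimGate` at an invalid index is the dummy empty sum. [cite: MalodPortier2008, Lemma 2] -/
theorem mdSimGate_of_not_valid {idx : ℕ} (h : ¬ P.MdValid D idx) :
    P.mdSimGate D idx = .sum [] := by
  unfold mdSimGate
  exact if_neg h

/-- An operand's formal degree is at most that of a sum gate containing it. [cite: Burgisser2006, §2.2] -/
theorem Operand.formalDegree_le_sum (degs : List ℕ) {args : List (k × Operand k σ)}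
    {a : k × Operand k σ} (ha : a ∈ args) :
    a.2.formalDegree degs ≤ (Gate.sum args).formalDegree degs := by
  simp only [Gate.formalDegree]
  exact le_foldr_max_of_mem (List.mem_map.2 ⟨a, ha, rfl⟩)

/-- Gate references among consecutive-offset copies: a reference produced by `mdCopyProd` is the
copy `(w, κ')` of a gate operand `gate w`, at an offset `κ' ≥ κ` with
`κ' + deg w ≤ κ + Σ deg`. [cite: MalodPortier2008, Lemma 2] -/
theorem mem_mdCopyProd (degs : List ℕ) (D : ℕ) :
    ∀ (κ : ℕ) (args : List (Operand k σ)) (j : ℕ),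
      Operand.gate j ∈ mdCopyProd degs D κ args →
        ∃ w κ', j = D * w + κ' ∧ Operand.gate w ∈ args ∧ κ ≤ κ' ∧
          κ' + degs.getD w 1 ≤ κ + (args.map fun u => u.formalDegree degs).sum
  | κ, [], j, h => by simp [mdCopyProd] at h
  | κ, u :: us, j, h => by
    simp only [mdCopyProd, List.mem_cons] at h
    rcases h with h | h
    · cases u with
      | var i => simp [Operand.mdCopy] at h
      | const c => simp [Operand.mdCopy] at h
      | gate w =>
        simp only [Operand.mdCopy, Operand.gate.injEq] at h
        refine ⟨w, κ, h, by simp, le_rfl, ?_⟩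
        simp only [List.map_cons, List.sum_cons, Operand.formalDegree]
        omega
    · obtain ⟨w, κ', hj, hw, hκ, hle⟩ := mem_mdCopyProd degs D _ us j h
      refine ⟨w, κ', hj, by simp [hw], by omega, ?_⟩
      simp only [List.map_cons, List.sum_cons]
      omega

/-- Gate references of a copied gate: the copy `(w, κ')` of a gate operand `gate w`, at an
offset `κ' ≥ κ` with `κ' + deg w ≤ κ + deg g`. [cite: MalodPortier2008, Lemma 2] -/
theorem mem_args_mdCopy (degs : List ℕ) (D κ : ℕ) (g : Gate k σ) {j : ℕ}
    (h : Operand.gate j ∈ (g.mdCopy degs D κ).args) :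
    ∃ w κ', j = D * w + κ' ∧ Operand.gate w ∈ g.args ∧ κ ≤ κ' ∧
      κ' + degs.getD w 1 ≤ κ + g.formalDegree degs := by
  cases g with
  | sum args =>
    simp only [Gate.mdCopy, Gate.args, List.map_map, List.mem_map, Function.comp_apply] at h
    obtain ⟨a, ha, hj⟩ := h
    have ha' : a.2 ∈ (Gate.sum args).args := by
      simp only [Gate.args, List.mem_map]
      exact ⟨a, ha, rfl⟩
    have hdeg := Operand.formalDegree_le_sum degs ha
    revert hj ha' hdeg
    cases a.2 with
    | var i => simp [Operand.mdCopy]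
    | const c => simp [Operand.mdCopy]
    | gate w =>
      intro hj ha' hdeg
      simp only [Operand.mdCopy, Operand.gate.injEq] at hj
      refine ⟨w, κ, hj.symm, ha', le_rfl, ?_⟩
      simp only [Operand.formalDegree] at hdeg
      omega
  | prod args =>
    simp only [Gate.mdCopy, Gate.args] at h
    obtain ⟨w, κ', hj, hw, hκ, hle⟩ := mem_mdCopyProd degs D κ args j h
    exact ⟨w, κ', hj, hw, hκ, by simpa [Gate.formalDegree] using hle⟩

/-- Earlier formal degrees seen from gate `p` are the final ones. [cite: Burgisser2006, §2.2] -/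
theorem getD_gateFormalDegrees_take_of_lt' (gs : List (Gate k σ)) {i p : ℕ} (hi : i < p) :
    (gateFormalDegrees (gs.take p)).getD i 1 = (gateFormalDegrees gs).getD i 1 := by
  rw [gateFormalDegrees_take_eq_take, List.getD_eq_getElem?_getD, List.getD_eq_getElem?_getD,
    List.getElem?_take, if_pos hi]

/-- In a well-formed circuit the formal degree of gate `v` may be computed against the FINAL list
of formal degrees (its operands are earlier gates). [cite: Burgisser2006, §2.2] -/
theorem gateDeg_eq_formalDegree (hwf : P.WellFormed) {v : ℕ} {g : Gate k σ}
    (hg : P.gates[v]? = some g) :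
    P.gateDeg v = g.formalDegree (gateFormalDegrees P.gates) := by
  unfold gateDeg
  rw [List.getD_eq_getElem?_getD, gateFormalDegrees_getElem?_of_eq P.gates v g hg, Option.getD_some]
  have hop : ∀ u ∈ g.args, u.formalDegree (gateFormalDegrees (P.gates.take v)) =
      u.formalDegree (gateFormalDegrees P.gates) := by
    intro u hu
    cases u with
    | var i => rfl
    | const c => rfl
    | gate w =>
      simp only [Operand.formalDegree]
      exact getD_gateFormalDegrees_take_of_lt' P.gates (hwf.1 v g hg (.gate w) hu)
  cases g with
  | sum args =>
    simp only [Gate.formalDegree]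
    congr 1
    refine List.map_congr_left fun a ha => hop a.2 ?_
    simp only [Gate.args, List.mem_map]
    exact ⟨a, ha, rfl⟩
  | prod args =>
    simp only [Gate.formalDegree]
    congr 1
    exact List.map_congr_left fun u hu => hop u hu

/-- **Placement arithmetic.** If gate `v = idx / D` (copy offset `κ = idx % D`, valid) has an
operand `gate w` placed at an offset `κ'` with `κ' + deg w ≤ κ + deg v`, then
`κ' < D`, `w < v`, the copy `(w, κ')` sits at an index `< idx`, and it is valid.
[cite: MalodPortier2008, Lemma 2] -/
theorem md_placement (hwf : P.WellFormed) (h1 : ∀ g ∈ P.gates, 1 ≤ g.fanIn) (hD : 0 < D)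
    {idx : ℕ} (hval : P.MdValid D idx) {g : Gate k σ} (hg : P.gates[idx / D]? = some g)
    {w κ' : ℕ} (hw : Operand.gate w ∈ g.args)
    (hle : κ' + P.gateDeg w ≤ idx % D + P.gateDeg (idx / D)) :
    κ' < D ∧ w < idx / D ∧ D * w + κ' < idx ∧ P.MdValid D (D * w + κ') ∧
      (D * w + κ') / D = w ∧ (D * w + κ') % D = κ' := by
  have hwv : w < idx / D := hwf.1 _ g hg (.gate w) hw
  have hdw : 1 ≤ P.gateDeg w := one_le_getD_gateFormalDegrees P.gates h1 w
  have hval' : idx % D + P.gateDeg (idx / D) ≤ D := hval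
  have hκD : κ' < D := by omega
  have hjdiv : (D * w + κ') / D = w := mdIndex_div hD w hκD
  have hjmod : (D * w + κ') % D = κ' := mdIndex_mod w hκD
  refine ⟨hκD, hwv, ?_, ?_, hjdiv, hjmod⟩
  · have h3 := Nat.div_add_mod idx D
    have h4 : D * w + D ≤ D * (idx / D) := by
      rw [← Nat.mul_succ]
      exact Nat.mul_le_mul_left D hwv
    omega
  · show (D * w + κ') % D + P.gateDeg ((D * w + κ') / D) ≤ D
    rw [hjdiv, hjmod]
    omega

/-- **Structure of the references of a valid copy.** In the simulation of a well-formed circuit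
without empty gates, a gate reference `gate j` of the (valid) copy `(v, κ)` is the copy `(w, κ')`
of an operand `gate w` of gate `v`, with `w < v`, `κ ≤ κ' < D`, `κ' + deg w ≤ κ + deg v`; in
particular `j < D * v + κ` and the copy `(w, κ')` is valid. [cite: MalodPortier2008, Lemma 2] -/
theorem mdSim_operand (hwf : P.WellFormed) (h1 : ∀ g ∈ P.gates, 1 ≤ g.fanIn) (hD : 0 < D)
    {idx : ℕ} (hval : P.MdValid D idx) {g : Gate k σ} (hg : P.gates[idx / D]? = some g) {j : ℕ}
    (hj : Operand.gate j ∈ (P.mdSimGate D idx).args) :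
    ∃ w κ', j = D * w + κ' ∧ κ' < D ∧ w < idx / D ∧ Operand.gate w ∈ g.args ∧
      idx % D ≤ κ' ∧ κ' + P.gateDeg w ≤ idx % D + P.gateDeg (idx / D) ∧
      j < idx ∧ P.MdValid D j ∧ j / D = w ∧ j % D = κ' := by
  rw [P.mdSimGate_of_valid hval, List.getD_eq_getElem?_getD, hg, Option.getD_some] at hj
  obtain ⟨w, κ', hjw, hw, hκ, hle⟩ := mem_args_mdCopy _ D _ g hj
  have hdegv := P.gateDeg_eq_formalDegree hwf hg
  have hle' : κ' + P.gateDeg w ≤ idx % D + P.gateDeg (idx / D) := by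
    unfold gateDeg at hdegv ⊢
    rw [hdegv]
    exact hle
  obtain ⟨hκD, hwv, hlt, hvalj, hdiv, hmod⟩ := P.md_placement hwf h1 hD hval hg hw hle'
  subst hjw
  exact ⟨w, κ', rfl, hκD, hwv, hw, hκ, hle', hlt, hvalj, hdiv, hmod⟩

/-- The simulation of a well-formed circuit without empty gates is well formed (for `D ≥ 1`).
[cite: Burgisser2024Completeness, Prop. 2.6] -/
theorem wellFormed_mdSim (hwf : P.WellFormed) (h1 : ∀ g ∈ P.gates, 1 ≤ g.fanIn) (hD : 0 < D) :
    (P.mdSim D).WellFormed := by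
  constructor
  · intro idx g' hg' u hu
    have hidx : idx < P.size * D := by
      have := (List.getElem?_eq_some_iff.1 hg').1
      simpa [mdSim] using this
    rw [P.mdSim_getElem? D hidx, Option.some.injEq] at hg'
    subst hg'
    cases u with
    | var i => trivial
    | const c => trivial
    | gate j =>
      by_cases hval : P.MdValid D idx
      · have hv : idx / D < P.size := by rwa [Nat.div_lt_iff_lt_mul hD]
        obtain ⟨g, hg⟩ : ∃ g, P.gates[idx / D]? = some g :=
          ⟨P.gates[idx / D]'hv, List.getElem?_eq_getElem hv⟩
        obtain ⟨w, κ', -, -, -, -, -, -, hjlt, -⟩ := P.mdSim_operand hwf h1 hD hval hg hu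
        exact hjlt
      · rw [P.mdSimGate_of_not_valid hval] at hu
        simp [Gate.args] at hu
  · show (P.output.mdCopy D 0).RefsBelow (P.mdSim D).size
    have hout := hwf.2
    cases ho : P.output with
    | var i => trivial
    | const c => trivial
    | gate j =>
      rw [ho] at hout
      change j < P.size at hout
      show D * j + 0 < (P.mdSim D).size
      rw [size_mdSim]
      nlinarith

end Analysis

section References

variable (P : ArithCircuit k σ) {D : ℕ}

/-- **Edges of the simulation go from valid copies to valid copies, downwards, inside the band:**
if copy `l` references copy `j`, then both are valid, `j < l`, and the offset band
`[j % D, j % D + deg)` of `j` lies inside that of `l`. [cite: MalodPortier2008, Lemma 2] -/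
theorem mdSim_references (hwf : P.WellFormed) (h1 : ∀ g ∈ P.gates, 1 ≤ g.fanIn) (hD : 0 < D)
    {l j : ℕ} (h : (P.mdSim D).References l j) :
    P.MdValid D l ∧ P.MdValid D j ∧ j < l ∧ l % D ≤ j % D ∧
      j % D + P.gateDeg (j / D) ≤ l % D + P.gateDeg (l / D) := by
  obtain ⟨g', hg', hjrefs⟩ := h
  have hl : l < P.size * D := by
    have := (List.getElem?_eq_some_iff.1 hg').1
    simpa [mdSim] using this
  rw [P.mdSim_getElem? D hl, Option.some.injEq] at hg'
  subst hg'
  have hmem := (mem_refs_iff _ j).1 hjrefs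
  by_cases hval : P.MdValid D l
  · have hv : l / D < P.size := by rwa [Nat.div_lt_iff_lt_mul hD]
    obtain ⟨g, hg⟩ : ∃ g, P.gates[l / D]? = some g :=
      ⟨P.gates[l / D]'hv, List.getElem?_eq_getElem hv⟩
    obtain ⟨w, κ', -, -, -, -, hκ, hle, hjlt, hvalj, hdiv, hmod⟩ :=
      P.mdSim_operand hwf h1 hD hval hg hmem
    refine ⟨hval, hvalj, hjlt, ?_, ?_⟩
    · rw [hmod]; exact hκ
    · rw [hdiv, hmod]; exact hle
  · rw [P.mdSimGate_of_not_valid hval] at hmem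
    simp [Gate.args] at hmem

/-- **Band invariant (path form):** along a path of references from copy `idx` to copy `x`, the
offset band of `x` stays inside that of `idx`. [cite: MalodPortier2008, Lemma 2] -/
theorem mdSim_band_of_reflTransGen (hwf : P.WellFormed) (h1 : ∀ g ∈ P.gates, 1 ≤ g.fanIn)
    (hD : 0 < D) {idx x : ℕ} (hx : Relation.ReflTransGen (P.mdSim D).References idx x) :
    idx % D ≤ x % D ∧ x % D + P.gateDeg (x / D) ≤ idx % D + P.gateDeg (idx / D) := by
  induction hx with
  | refl => exact ⟨le_rfl, le_rfl⟩
  | tail _ hyx ih =>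
    obtain ⟨-, -, -, hκ, hle⟩ := P.mdSim_references hwf h1 hD hyx
    exact ⟨ih.1.trans hκ, hle.trans ih.2⟩

/-- **Band invariant:** every copy `x` in the sub-circuit of copy `idx` has its offset band inside
that of `idx`: `idx % D ≤ x % D` and `x % D + deg(x / D) ≤ idx % D + deg(idx / D)`.
[cite: MalodPortier2008, Lemma 2] -/
theorem mdSim_subcircuit_band (hwf : P.WellFormed) (h1 : ∀ g ∈ P.gates, 1 ≤ g.fanIn) (hD : 0 < D)
    {idx x : ℕ} (hx : x ∈ (P.mdSim D).subcircuit idx) :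
    idx % D ≤ x % D ∧ x % D + P.gateDeg (x / D) ≤ idx % D + P.gateDeg (idx / D) :=
  P.mdSim_band_of_reflTransGen hwf h1 hD hx

/-- **The simulation is multiplicatively disjoint** (well-formed fan-in-two circuits without empty
gates, `D ≥ 1`): at a product copy `(v, κ) = (w₁, κ) · (w₂, κ + deg w₁)` the two factor
sub-circuits live in the disjoint offset bands `[κ, κ + deg w₁)` and
`[κ + deg w₁, κ + deg w₁ + deg w₂)` (every copy has `deg ≥ 1`), so they are disjoint — even
when `w₁ = w₂`. [cite: Burgisser2024Completeness, Prop. 2.6] [cite: MalodPortier2008, Lemma 2] -/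
theorem isMultiplicativelyDisjoint_mdSim (hwf : P.WellFormed) (h2 : P.IsFanInTwo)
    (h1 : ∀ g ∈ P.gates, 1 ≤ g.fanIn) (hD : 0 < D) :
    (P.mdSim D).IsMultiplicativelyDisjoint := by
  intro l args' hg'
  have hl : l < P.size * D := by
    have := (List.getElem?_eq_some_iff.1 hg').1
    simpa [mdSim] using this
  rw [P.mdSim_getElem? D hl, Option.some.injEq] at hg'
  by_cases hval : P.MdValid D l
  · have hv : l / D < P.size := by rwa [Nat.div_lt_iff_lt_mul hD]
    obtain ⟨g, hg⟩ : ∃ g, P.gates[l / D]? = some g :=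
      ⟨P.gates[l / D]'hv, List.getElem?_eq_getElem hv⟩
    rw [P.mdSimGate_of_valid hval, List.getD_eq_getElem?_getD, hg, Option.getD_some] at hg'
    have hdegv := P.gateDeg_eq_formalDegree hwf hg
    have hval' : l % D + P.gateDeg (l / D) ≤ D := hval
    cases g with
    | sum args => simp [Gate.mdCopy] at hg'
    | prod args =>
      simp only [Gate.mdCopy, Gate.prod.injEq] at hg'
      subst hg'
      have hfan : args.length ≤ 2 := by
        have := h2 (.prod args) (List.mem_of_getElem? hg)
        simpa [Gate.fanIn, Gate.args] using this
      rcases args with _ | ⟨u₁, _ | ⟨u₂, _ | ⟨u₃, rest⟩⟩⟩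
      · simp [mdCopyProd, Gate.refs, Gate.args]
      · cases u₁ <;> simp [mdCopyProd, Operand.mdCopy, Gate.refs, Gate.args]
      · cases u₁ with
        | var x => cases u₂ <;> simp [mdCopyProd, Operand.mdCopy, Gate.refs, Gate.args]
        | const c => cases u₂ <;> simp [mdCopyProd, Operand.mdCopy, Gate.refs, Gate.args]
        | gate w₁ =>
          cases u₂ with
          | var x => simp [mdCopyProd, Operand.mdCopy, Gate.refs, Gate.args]
          | const c => simp [mdCopyProd, Operand.mdCopy, Gate.refs, Gate.args]
          | gate w₂ =>
            simp only [mdCopyProd, Operand.mdCopy, Operand.formalDegree]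
            rw [refs_prod_pair, List.pairwise_pair, Set.disjoint_iff]
            rintro x ⟨hx₁, hx₂⟩
            have hb₁ := P.mdSim_subcircuit_band hwf h1 hD hx₁
            have hb₂ := P.mdSim_subcircuit_band hwf h1 hD hx₂
            have hd₁ : 1 ≤ P.gateDeg w₁ := one_le_getD_gateFormalDegrees P.gates h1 w₁
            have hd₂ : 1 ≤ P.gateDeg w₂ := one_le_getD_gateFormalDegrees P.gates h1 w₂
            have hdx : 1 ≤ P.gateDeg (x / D) := one_le_getD_gateFormalDegrees P.gates h1 _
            have hsum : P.gateDeg (l / D) = P.gateDeg w₁ + P.gateDeg w₂ := by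
              rw [hdegv]
              simp [Gate.formalDegree, Operand.formalDegree, gateDeg]
            have hδ₁ : (gateFormalDegrees P.gates).getD w₁ 1 = P.gateDeg w₁ := rfl
            rw [hδ₁] at hb₂
            have hκ₁ : l % D < D := Nat.mod_lt _ hD
            have hκ₂ : l % D + P.gateDeg w₁ < D := by omega
            rw [mdIndex_mod w₁ hκ₁, mdIndex_div hD w₁ hκ₁] at hb₁
            rw [mdIndex_mod w₂ hκ₂, mdIndex_div hD w₂ hκ₂] at hb₂
            omega
      · simp at hfan
  · rw [P.mdSimGate_of_not_valid hval] at hg'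
    simp at hg'

end References

section Values

variable [CommSemiring k]

/-- Evaluating a longer gate list extends the list of values. [cite: Burgisser2000, Def. 2.1] -/
private theorem exists_gateValues_append_eq'' (l₁ l₂ : List (Gate k σ)) :
    ∃ r, gateValues (l₁ ++ l₂) = gateValues l₁ ++ r ∧ r.length = l₂.length := by
  induction l₂ using List.reverseRecOn with
  | nil => exact ⟨[], by simp, rfl⟩
  | append_singleton l₂ g ih =>
    obtain ⟨r, hr, hlen⟩ := ih
    refine ⟨r ++ [g.eval (gateValues (l₁ ++ l₂))], ?_, by simp [hlen]⟩
    rw [← List.append_assoc, gateValues_append_singleton, hr, List.append_assoc]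

/-- The value of gate `p` is its evaluation against the values of the earlier gates.
[cite: Burgisser2000, Def. 2.1] -/
private theorem getD_gateValues_eq_eval' (gs : List (Gate k σ)) (p : ℕ) (g : Gate k σ)
    (hg : gs[p]? = some g) :
    (gateValues gs).getD p 0 = g.eval (gateValues (gs.take p)) := by
  obtain ⟨hp, hpg⟩ := List.getElem?_eq_some_iff.1 hg
  have hsplit : gs = (gs.take p ++ [g]) ++ gs.drop (p + 1) := by
    rw [List.append_assoc, List.singleton_append, ← hpg, ← List.drop_eq_getElem_cons hp,
      List.take_append_drop]
  obtain ⟨r, hr, -⟩ := exists_gateValues_append_eq'' (gs.take p ++ [g]) (gs.drop (p + 1))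
  rw [← hsplit, gateValues_append_singleton] at hr
  have hlen : (gateValues (gs.take p)).length = p := by
    rw [gateValues_length, List.length_take]
    omega
  rw [List.getD_eq_getElem?_getD, hr, List.append_assoc, List.getElem?_append_right (by omega),
    hlen, Nat.sub_self]
  simp

/-- Earlier values seen from gate `p` are the final values. [cite: Burgisser2000, Def. 2.1] -/
private theorem getD_gateValues_take_of_lt' (gs : List (Gate k σ)) {i p : ℕ} (hi : i < p) :
    (gateValues (gs.take p)).getD i 0 = (gateValues gs).getD i 0 := by
  obtain ⟨r, hr, -⟩ := exists_gateValues_append_eq'' (gs.take p) (gs.drop p)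
  rw [List.take_append_drop] at hr
  rw [hr, List.getD_eq_getElem?_getD, List.getD_eq_getElem?_getD]
  by_cases hi' : i < (gateValues (gs.take p)).length
  · rw [List.getElem?_append_left hi']
  · have hlen : (gateValues (gs.take p)).length = min p gs.length := by
      rw [gateValues_length, List.length_take]
    have htake : gs.take p = gs := List.take_of_length_le (by omega)
    rw [htake] at hr ⊢
    have hr' : r = [] := by
      have h := congrArg List.length hr
      simp only [List.length_append] at h
      exact List.eq_nil_of_length_eq_zero (by omega)
    rw [hr', List.append_nil]

variable (P : ArithCircuit k σ) {D : ℕ}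

/-- **Correctness of the simulation:** every valid copy `(v, κ)` computes the value of gate `v`
(strong induction on the index: the operands of a valid copy are valid copies of earlier gates).
[cite: Burgisser2024Completeness, Prop. 2.6] [cite: MalodPortier2008, Lemma 2] -/
theorem mdSim_value (hwf : P.WellFormed) (h2 : P.IsFanInTwo) (h1 : ∀ g ∈ P.gates, 1 ≤ g.fanIn)
    (hD : 0 < D) :
    ∀ idx : ℕ, P.MdValid D idx → idx < P.size * D →
      (gateValues (P.mdSim D).gates).getD idx 0 = (gateValues P.gates).getD (idx / D) 0 := by
  intro idx
  induction idx using Nat.strong_induction_on with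
  | _ idx ih =>
  intro hval hidx
  have hv : idx / D < P.size := by rwa [Nat.div_lt_iff_lt_mul hD]
  obtain ⟨g, hg⟩ : ∃ g, P.gates[idx / D]? = some g :=
    ⟨P.gates[idx / D]'hv, List.getElem?_eq_getElem hv⟩
  rw [getD_gateValues_eq_eval' _ idx _ (P.mdSim_getElem? D hidx),
    getD_gateValues_eq_eval' _ (idx / D) g hg, P.mdSimGate_of_valid hval,
    List.getD_eq_getElem?_getD, hg, Option.getD_some]
  have hdegv := P.gateDeg_eq_formalDegree hwf hg
  -- an operand placed inside the band evaluates to the original operand's value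
  have hop : ∀ (u : Operand k σ) (κ' : ℕ), u ∈ g.args →
      κ' + u.formalDegree (gateFormalDegrees P.gates) ≤ idx % D + P.gateDeg (idx / D) →
      (u.mdCopy D κ').eval (gateValues ((P.mdSim D).gates.take idx)) =
        u.eval (gateValues (P.gates.take (idx / D))) := by
    intro u κ' hu hle
    cases u with
    | var i => rfl
    | const c => rfl
    | gate w =>
      obtain ⟨hκD, hwv, hlt, hvalw, hdiv, -⟩ := P.md_placement hwf h1 hD hval hg hu hle
      simp only [Operand.mdCopy, Operand.eval_gate]
      rw [getD_gateValues_take_of_lt' _ hlt, getD_gateValues_take_of_lt' _ hwv,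
        ih _ hlt hvalw (hlt.trans hidx), hdiv]
  cases g with
  | sum args =>
    simp only [Gate.mdCopy, Gate.eval, List.map_map]
    congr 1
    refine List.map_congr_left fun a ha => ?_
    simp only [Function.comp_apply]
    have hmem : a.2 ∈ (Gate.sum args).args := by
      simp only [Gate.args, List.mem_map]
      exact ⟨a, ha, rfl⟩
    have hale := Operand.formalDegree_le_sum (gateFormalDegrees P.gates) ha
    rw [hop a.2 (idx % D) hmem (by omega)]
  | prod args =>
    have hfan : args.length ≤ 2 := by
      have := h2 (.prod args) (List.mem_of_getElem? hg)
      simpa [Gate.fanIn, Gate.args] using this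
    rcases args with _ | ⟨u₁, _ | ⟨u₂, _ | ⟨u₃, rest⟩⟩⟩
    · simp [Gate.mdCopy, mdCopyProd, Gate.eval]
    · simp only [Gate.mdCopy, mdCopyProd, Gate.eval, List.map_cons, List.map_nil]
      simp only [Gate.formalDegree, List.map_cons, List.map_nil, List.sum_cons, List.sum_nil,
        add_zero] at hdegv
      rw [hop u₁ (idx % D) (by simp [Gate.args]) (by omega)]
    · simp only [Gate.mdCopy, mdCopyProd, Gate.eval, List.map_cons, List.map_nil]
      simp only [Gate.formalDegree, List.map_cons, List.map_nil, List.sum_cons, List.sum_nil,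
        add_zero] at hdegv
      rw [hop u₁ (idx % D) (by simp [Gate.args]) (by omega),
        hop u₂ (idx % D + u₁.formalDegree (gateFormalDegrees P.gates)) (by simp [Gate.args])
          (by omega)]
    · simp at hfan

/-- **The simulation computes the same polynomial** (the output is the copy at offset `0` of the
output gate, valid because `deg P ≤ D`). [cite: Burgisser2024Completeness, Prop. 2.6] -/
theorem eval_mdSim (hwf : P.WellFormed) (h2 : P.IsFanInTwo) (h1 : ∀ g ∈ P.gates, 1 ≤ g.fanIn)
    (hD : 0 < D) (hdeg : P.formalDegree ≤ D) : (P.mdSim D).eval = P.eval := by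
  unfold ArithCircuit.eval
  show (P.output.mdCopy D 0).eval _ = _
  have hout := hwf.2
  cases ho : P.output with
  | var i => rfl
  | const c => rfl
  | gate j =>
    rw [ho] at hout
    change j < P.size at hout
    have hdj : P.gateDeg j ≤ D := by
      have : P.formalDegree = P.gateDeg j := by
        unfold ArithCircuit.formalDegree gateDeg
        rw [ho]
        rfl
      omega
    have hvalid : P.MdValid D (D * j + 0) := by
      show (D * j + 0) % D + P.gateDeg ((D * j + 0) / D) ≤ D
      rw [mdIndex_mod j hD, mdIndex_div hD j hD]
      omega
    have hlt : D * j + 0 < P.size * D := by nlinarith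
    simp only [Operand.mdCopy, Operand.eval_gate]
    rw [P.mdSim_value hwf h2 h1 hD _ hvalid hlt, mdIndex_div hD j hD]

end Values

section Assembly

variable [CommSemiring k]

/-- **Bürgisser 2024, Prop. 2.6 (Malod–Portier 2008, Lemma 2: «If `C` is a circuit of size `t`
and degree `d`, there exists a MD circuit `C'`, which computes the same polynomial and whose size
is less than `dt`»).** For a well-formed fan-in-two circuit `P` without empty gates there is a
well-formed fan-in-two MULTIPLICATIVELY DISJOINT circuit computing the same polynomial, with
exactly `P.size * P.formalDegree` gates (`formalDegree` = the degree `d` of the circuit; the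
tree's `size` counts gates only). [cite: Burgisser2024Completeness, Prop. 2.6]
[cite: MalodPortier2008, Lemma 2] -/
theorem exists_isMultiplicativelyDisjoint_eval_eq (P : ArithCircuit k σ) (hwf : P.WellFormed)
    (h2 : P.IsFanInTwo) (h1 : ∀ g ∈ P.gates, 1 ≤ g.fanIn) :
    ∃ Q : ArithCircuit k σ, Q.WellFormed ∧ Q.IsFanInTwo ∧ Q.IsMultiplicativelyDisjoint ∧
      Q.eval = P.eval ∧ Q.size = P.size * P.formalDegree := by
  have hD : 0 < P.formalDegree := one_le_formalDegree P h1
  exact ⟨P.mdSim P.formalDegree, P.wellFormed_mdSim hwf h1 hD, P.isFanInTwo_mdSim _ h2,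
    P.isMultiplicativelyDisjoint_mdSim hwf h2 h1 hD, P.eval_mdSim hwf h2 h1 hD le_rfl,
    P.size_mdSim _⟩

/-- **Prop. 2.6 for a polynomial:** `f` is computed by a well-formed fan-in-two multiplicatively
disjoint circuit of size `≤ (deg(f)² · L(f) + deg f) · max(deg f, 1)` — homogenise to formal
degree `≤ max(deg f, 1)` (`exists_computes_formalDegree_le_totalDegree`, BCS (21.25)), then
simulate. [cite: Burgisser2024Completeness, Prop. 2.6] -/
theorem exists_isMultiplicativelyDisjoint_computes (f : MvPolynomial σ k) :
    ∃ Q : ArithCircuit k σ, Q.WellFormed ∧ Q.IsFanInTwo ∧ Q.IsMultiplicativelyDisjoint ∧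
      Q.Computes f ∧
      Q.size ≤ (f.totalDegree ^ 2 * complexity f + f.totalDegree) * max f.totalDegree 1 := by
  obtain ⟨P, hfan, h2, hwf, hf, hsize, hdeg⟩ := exists_computes_formalDegree_le_totalDegree f
  have h1 : ∀ g ∈ P.gates, 1 ≤ g.fanIn := fun g hg => by rw [hfan g hg]; omega
  obtain ⟨Q, hQwf, hQ2, hQmd, hQeval, hQsize⟩ := exists_isMultiplicativelyDisjoint_eval_eq P hwf h2 h1
  refine ⟨Q, hQwf, hQ2, hQmd, ?_, ?_⟩
  · have hf' : P.eval = f := hf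
    show Q.eval = f
    rw [hQeval, hf']
  · rw [hQsize]
    exact Nat.mul_le_mul hsize hdeg

end Assembly

end ArithCircuit

/-! ## Def. 2.9(1) = Rem. 2.10(1): the survey's `VP` is the tree's `VP` -/

section Classes

open ArithCircuit

/-- **Malod–Portier 2008, Thm. 1 («A sequence of polynomials `(f_n)` belongs to `VP` if and only
if there exists a sequence `(C_n)` of MD circuits, of polynomially bounded size, such that `C_n`
represents the polynomial `f_n`») = Bürgisser 2024, Def. 2.9(1) ⟺ Rem. 2.10(1).** A family `f`
is in the tree's `VP` (p-bounded number of variables, degree and circuit complexity — the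
characterisation of Rem. 2.10(1)) iff it has p-bounded many variables and well-formed fan-in-two
multiplicatively disjoint circuits of p-bounded size (the survey's Def. 2.9(1)).
[cite: MalodPortier2008, Thm. 1] [cite: Burgisser2024Completeness, Def. 2.9(1), Rem. 2.10(1)] -/
theorem isVPFamily_iff_exists_isMultiplicativelyDisjoint {k : Type*} [CommSemiring k]
    {σ : ℕ → Type*} [∀ n, Fintype (σ n)] {f : ∀ n, MvPolynomial (σ n) k} :
    IsVPFamily f ↔
      IsPBounded (fun n => Fintype.card (σ n)) ∧ ∃ s : ℕ → ℕ, IsPBounded s ∧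
        ∀ n, ∃ Q : ArithCircuit k (σ n), Q.WellFormed ∧ Q.IsFanInTwo ∧
          Q.IsMultiplicativelyDisjoint ∧ Q.Computes (f n) ∧ Q.size ≤ s n := by
  constructor
  · intro hf
    have hd : IsPBounded fun n => (f n).totalDegree := hf.1.2
    have hL : IsPBounded fun n => complexity (f n) := hf.2
    refine ⟨hf.1.1, fun n => ((f n).totalDegree ^ 2 * complexity (f n) + (f n).totalDegree) *
      max (f n).totalDegree 1, ?_, fun n => exists_isMultiplicativelyDisjoint_computes (f n)⟩
    refine IsPBounded.mul_holds (IsPBounded.add_holds (IsPBounded.mul_holds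
      (IsPBounded.pow_holds hd 2) hL) hd) ?_
    exact (IsPBounded.add_holds hd (IsPBounded.const 1)).mono fun n => by
      show max (f n).totalDegree 1 ≤ (f n).totalDegree + 1
      omega
  · rintro ⟨hσ, s, hs, hQ⟩
    exact isVPFamily_of_isMultiplicativelyDisjoint hσ hs hQ

end Classes

/-! ## Constants and formal degrees of the simulation; the weight bound `wt ≤ 2^(|P|·deg P + deg P)`
(appended; cell `val-lit`, row Bur2024-A, p0015 L44–L48)

> We note that these constant-free classes consist of sequences `(f_n)` of multivariate
> polynomials with integer coefficients whose degree and bitsize grow at most polynomially in `n`.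

The simulation keeps the constants and sum coefficients of `P` (`hasSignConstants_mdSim`) and the
formal degrees of the copied gates (`gateDeg_mdSim`, `formalDegree_mdSim`); with Lemma 4.1(2)
(`weight_eval_le_of_isMultiplicativelyDisjoint`, `MultiplicativelyDisjointCircuits.lean`) this gives
the single-exponential weight bound for constant-free circuits of bounded FORMAL degree:
`ArithCircuit.weight_eval_le_of_formalDegree` — `wt(P.eval) ≤ 2 ^ (|P| · deg P + deg P)`
(versus `2 ^ 2 ^ |P|` without the degree, `weight_eval_le_two_pow_two_pow_size`).
[cite: Burgisser2024Completeness, §4.1 (after Def. 4.2)] -/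

namespace ArithCircuit

section Constants

variable {k : Type*} {σ : Type*} [Zero k] [One k] [Add k]

/-- Copying does not change the constants of an operand. [cite: MalodPortier2008, Lemma 2] -/
theorem Operand.hasSignConstants_mdCopy (D κ : ℕ) {u : Operand k σ} (hu : u.HasSignConstants) :
    (u.mdCopy D κ).HasSignConstants := by
  cases u with
  | var i => trivial
  | const c => exact hu
  | gate w => trivial

omit [Zero k] [One k] [Add k] in
/-- Every operand produced by `mdCopyProd` is a copy of an operand of the list.
[cite: MalodPortier2008, Lemma 2] -/
theorem exists_of_mem_mdCopyProd (degs : List ℕ) (D : ℕ) :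
    ∀ (κ : ℕ) (args : List (Operand k σ)) (u' : Operand k σ), u' ∈ mdCopyProd degs D κ args →
      ∃ u ∈ args, ∃ κ', u' = u.mdCopy D κ'
  | κ, [], u', h => by simp [mdCopyProd] at h
  | κ, u :: us, u', h => by
    simp only [mdCopyProd, List.mem_cons] at h
    rcases h with rfl | h
    · exact ⟨u, by simp, κ, rfl⟩
    · obtain ⟨u₀, hu₀, κ', rfl⟩ := exists_of_mem_mdCopyProd degs D _ us u' h
      exact ⟨u₀, by simp [hu₀], κ', rfl⟩

/-- Copying does not change the constants and coefficients of a gate. [cite: MalodPortier2008, Lemma 2] -/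
theorem Gate.hasSignConstants_mdCopy (degs : List ℕ) (D κ : ℕ) {g : Gate k σ}
    (hg : g.HasSignConstants) : (g.mdCopy degs D κ).HasSignConstants := by
  cases g with
  | sum args =>
    intro a ha
    simp only [List.mem_map] at ha
    obtain ⟨b, hb, rfl⟩ := ha
    exact ⟨(hg b hb).1, Operand.hasSignConstants_mdCopy D κ (hg b hb).2⟩
  | prod args =>
    intro u' hu'
    obtain ⟨u, hu, κ', rfl⟩ := exists_of_mem_mdCopyProd degs D κ args u' hu'
    exact Operand.hasSignConstants_mdCopy D κ' (hg u hu)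

/-- **The simulation of a constant-free circuit is constant free.** [cite: Burgisser2024Completeness, Prop. 2.6] -/
theorem hasSignConstants_mdSim (P : ArithCircuit k σ) (D : ℕ) (hsc : P.HasSignConstants) :
    (P.mdSim D).HasSignConstants := by
  constructor
  · intro g hg
    simp only [mdSim, List.mem_map, List.mem_range] at hg
    obtain ⟨idx, -, rfl⟩ := hg
    unfold mdSimGate
    split_ifs with hval
    · rw [List.getD_eq_getElem?_getD]
      cases hg' : P.gates[idx / D]? with
      | none =>
        simp only [Option.getD_none]
        intro a ha
        simp at ha
      | some g =>
        simp only [Option.getD_some]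
        exact Gate.hasSignConstants_mdCopy _ D _ (hsc.1 g (List.mem_of_getElem? hg'))
    · intro a ha
      simp at ha
  · exact Operand.hasSignConstants_mdCopy D 0 hsc.2

end Constants

section FormalDegrees

variable {k : Type*} {σ : Type*} (P : ArithCircuit k σ) {D : ℕ}

/-- **The copies keep the formal degrees:** a valid copy `(v, κ)` has the formal degree of gate
`v`. [cite: MalodPortier2008, Lemma 2] -/
theorem gateDeg_mdSim (hwf : P.WellFormed) (h2 : P.IsFanInTwo) (h1 : ∀ g ∈ P.gates, 1 ≤ g.fanIn)
    (hD : 0 < D) :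
    ∀ idx : ℕ, P.MdValid D idx → idx < P.size * D →
      (P.mdSim D).gateDeg idx = P.gateDeg (idx / D) := by
  intro idx
  induction idx using Nat.strong_induction_on with
  | _ idx ih =>
  intro hval hidx
  have hv : idx / D < P.size := by rwa [Nat.div_lt_iff_lt_mul hD]
  obtain ⟨g, hg⟩ : ∃ g, P.gates[idx / D]? = some g :=
    ⟨P.gates[idx / D]'hv, List.getElem?_eq_getElem hv⟩
  rw [(P.mdSim D).gateDeg_eq_formalDegree (P.wellFormed_mdSim hwf h1 hD) (P.mdSim_getElem? D hidx),
    P.gateDeg_eq_formalDegree hwf hg, P.mdSimGate_of_valid hval, List.getD_eq_getElem?_getD, hg,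
    Option.getD_some]
  -- an operand placed inside the band keeps its formal degree
  have hop : ∀ (u : Operand k σ) (κ' : ℕ), u ∈ g.args →
      κ' + u.formalDegree (gateFormalDegrees P.gates) ≤ idx % D + P.gateDeg (idx / D) →
      (u.mdCopy D κ').formalDegree (gateFormalDegrees (P.mdSim D).gates) =
        u.formalDegree (gateFormalDegrees P.gates) := by
    intro u κ' hu hle
    cases u with
    | var i => rfl
    | const c => rfl
    | gate w =>
      obtain ⟨-, -, hlt, hvalw, hdiv, -⟩ := P.md_placement hwf h1 hD hval hg hu hle
      have h := ih _ hlt hvalw (hlt.trans hidx)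
      rw [hdiv] at h
      exact h
  have hdegv := P.gateDeg_eq_formalDegree hwf hg
  cases g with
  | sum args =>
    simp only [Gate.mdCopy, Gate.formalDegree, List.map_map]
    congr 1
    refine List.map_congr_left fun a ha => ?_
    simp only [Function.comp_apply]
    have hmem : a.2 ∈ (Gate.sum args).args := by
      simp only [Gate.args, List.mem_map]
      exact ⟨a, ha, rfl⟩
    have hale := Operand.formalDegree_le_sum (gateFormalDegrees P.gates) ha
    exact hop a.2 (idx % D) hmem (by omega)
  | prod args =>
    have hfan : args.length ≤ 2 := by
      have := h2 (.prod args) (List.mem_of_getElem? hg)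
      simpa [Gate.fanIn, Gate.args] using this
    rcases args with _ | ⟨u₁, _ | ⟨u₂, _ | ⟨u₃, rest⟩⟩⟩
    · simp [Gate.mdCopy, mdCopyProd, Gate.formalDegree]
    · simp only [Gate.mdCopy, mdCopyProd, Gate.formalDegree, List.map_cons, List.map_nil]
      simp only [Gate.formalDegree, List.map_cons, List.map_nil, List.sum_cons, List.sum_nil,
        add_zero] at hdegv
      rw [hop u₁ (idx % D) (by simp [Gate.args]) (by omega)]
    · simp only [Gate.mdCopy, mdCopyProd, Gate.formalDegree, List.map_cons, List.map_nil]
      simp only [Gate.formalDegree, List.map_cons, List.map_nil, List.sum_cons, List.sum_nil,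
        add_zero] at hdegv
      rw [hop u₁ (idx % D) (by simp [Gate.args]) (by omega),
        hop u₂ (idx % D + u₁.formalDegree (gateFormalDegrees P.gates)) (by simp [Gate.args])
          (by omega)]
    · simp at hfan

/-- **The simulation has the formal degree of `P`** (when `deg P ≤ D`). [cite: Burgisser2024Completeness, Prop. 2.6] -/
theorem formalDegree_mdSim (hwf : P.WellFormed) (h2 : P.IsFanInTwo)
    (h1 : ∀ g ∈ P.gates, 1 ≤ g.fanIn) (hD : 0 < D) (hdeg : P.formalDegree ≤ D) :
    (P.mdSim D).formalDegree = P.formalDegree := by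
  unfold ArithCircuit.formalDegree
  show (P.output.mdCopy D 0).formalDegree _ = _
  have hout := hwf.2
  cases ho : P.output with
  | var i => rfl
  | const c => rfl
  | gate j =>
    rw [ho] at hout
    change j < P.size at hout
    have hdj : P.gateDeg j ≤ D := by
      have : P.formalDegree = P.gateDeg j := by
        unfold ArithCircuit.formalDegree gateDeg
        rw [ho]
        rfl
      omega
    have hvalid : P.MdValid D (D * j + 0) := by
      show (D * j + 0) % D + P.gateDeg ((D * j + 0) / D) ≤ D
      rw [mdIndex_mod j hD, mdIndex_div hD j hD]
      omega
    have hlt : D * j + 0 < P.size * D := by nlinarith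
    have h := P.gateDeg_mdSim hwf h2 h1 hD _ hvalid hlt
    rw [mdIndex_div hD j hD] at h
    exact h

end FormalDegrees

section WeightBound

variable {σ : Type*}

/-- **Weight bound for constant-free circuits of bounded formal degree** (the content of
Bürgisser 2024, §4.1: «these constant-free classes consist of sequences `(f_n)` of … integer
polynomials whose degree and bitsize grow at most polynomially», via Prop. 2.6 and Lemma 4.1(2)):
a well-formed fan-in-two constant-free circuit `P` without empty gates computes a polynomial of
weight `≤ 2 ^ (|P| · deg P + deg P)`, `deg P` the formal degree — simulate `P` by a
multiplicatively disjoint constant-free circuit with `|P| · deg P` gates and the same formal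
degree, and apply the weight bound `2 ^ (size + formal degree)` for such circuits.
[cite: Burgisser2024Completeness, §4.1 (after Def. 4.2), Prop. 2.6, Lemma 4.1(2)] -/
theorem weight_eval_le_of_formalDegree (P : ArithCircuit ℤ σ) (hwf : P.WellFormed)
    (h2 : P.IsFanInTwo) (h1 : ∀ g ∈ P.gates, 1 ≤ g.fanIn) (hsc : P.HasSignConstants) :
    weight P.eval ≤ 2 ^ (P.size * P.formalDegree + P.formalDegree) := by
  have hD : 0 < P.formalDegree := one_le_formalDegree P h1
  have h := weight_eval_le_of_isMultiplicativelyDisjoint (P.mdSim P.formalDegree)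
    (P.wellFormed_mdSim hwf h1 hD) (P.isFanInTwo_mdSim _ h2) (P.hasSignConstants_mdSim _ hsc)
    (P.isMultiplicativelyDisjoint_mdSim hwf h2 h1 hD)
  rwa [P.eval_mdSim hwf h2 h1 hD le_rfl, size_mdSim, P.formalDegree_mdSim hwf h2 h1 hD le_rfl] at h

end WeightBound

end ArithCircuit

/-! ## Bitsize of `VP⁰`-type families: `log₂ wt(f_n)` is p-bounded (appended)

Class-level form of `weight_eval_le_of_formalDegree` for families computed by fan-in-two
constant-free circuits WITHOUT EMPTY GATES of p-bounded size and formal degree — the printed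
model of Bürgisser 2024, Def. 4.2 / Bürgisser 2009, Def. 2.7 (every gate has two children):
`isPBounded_log_weight_of_circuits`. The hypothesis «no empty gates» is necessary in the tree's
straight-line model: an empty product gate (value `1`) and sums of it manufacture the constant
`2 ^ 2 ^ n` with `O(n)` gates of formal degree `0`, so `2 ^ 2 ^ n · X` has constant-free circuits
of size `O(n)` and formal degree `1` but bitsize `2 ^ n` (the tree's `IsVP0Family`, which allows
such gates, is to that extent more liberal than print; cf. the cell's erratum B41).
[cite: Burgisser2024Completeness, §4.1 (after Def. 4.2)] -/

namespace ArithCircuit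


section Bitsize

variable {σ : Type*}

/-- `weight_eval_le_of_formalDegree` without the well-formedness hypothesis (junk references are
first trimmed, `trimJunk`, which keeps size, formal degree (`formalDegree_trimJunk`,
`ZModCircuitIntegerCodes.lean`), fan-in, constants and value).
[cite: Burgisser2024Completeness, §4.1 (after Def. 4.2)] -/
theorem weight_eval_le_of_formalDegree' (P : ArithCircuit ℤ σ) (h2 : P.IsFanInTwo)
    (h1 : ∀ g ∈ P.gates, 1 ≤ g.fanIn) (hsc : P.HasSignConstants) :
    weight P.eval ≤ 2 ^ (P.size * P.formalDegree + P.formalDegree) := by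
  have h1' : ∀ g ∈ P.trimJunk.gates, 1 ≤ g.fanIn := by
    intro g hg
    simp only [ArithCircuit.trimJunk, List.mem_mapIdx] at hg
    obtain ⟨i, hi, rfl⟩ := hg
    rw [Gate.fanIn_truncate]
    exact h1 _ (List.getElem_mem hi)
  have h := weight_eval_le_of_formalDegree P.trimJunk (wellFormed_trimJunk P) h2.trimJunk h1'
    hsc.trimJunk
  rwa [eval_trimJunk, size_trimJunk, formalDegree_trimJunk] at h

end Bitsize

end ArithCircuit

section BitsizeFamilies

open ArithCircuit

/-- **Bürgisser 2024, §4.1 (after Def. 4.2): families of the constant-free classes have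
polynomially bounded bitsize** — for families computed by fan-in-two constant-free circuits
without empty gates whose size and formal degree are p-bounded (the printed `VP⁰` model),
`n ↦ log₂ wt(f_n)` is p-bounded: `log₂ wt(f_n) ≤ |C_n| · deg C_n + deg C_n`.
[cite: Burgisser2024Completeness, §4.1 (after Def. 4.2)] -/
theorem isPBounded_log_weight_of_circuits {σ : ℕ → Type*} {f : ∀ n, MvPolynomial (σ n) ℤ}
    (C : ∀ n, ArithCircuit ℤ (σ n))
    (hC : ∀ n, (C n).IsFanInTwo ∧ (∀ g ∈ (C n).gates, 1 ≤ g.fanIn) ∧ (C n).HasSignConstants ∧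
      (C n).Computes (f n))
    (hs : IsPBounded fun n => (C n).size) (hd : IsPBounded fun n => (C n).formalDegree) :
    IsPBounded fun n => Nat.log 2 (weight (f n)) := by
  refine (IsPBounded.add_holds (IsPBounded.mul_holds hs hd) hd).mono fun n => ?_
  obtain ⟨h2, h1, hsc, hf⟩ := hC n
  have h := weight_eval_le_of_formalDegree' (C n) h2 h1 hsc
  have hf' : (C n).eval = f n := hf
  rw [hf'] at h
  calc Nat.log 2 (weight (f n)) ≤ Nat.log 2 (2 ^ ((C n).size * (C n).formalDegree +
      (C n).formalDegree)) := Nat.log_mono_right h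
    _ = (C n).size * (C n).formalDegree + (C n).formalDegree := Nat.log_pow (by norm_num) _

end BitsizeFamilies

end Literature.Computability.AlgebraicComplexity
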